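import Summits.HodgeConjecture.HodgeConjecture.Theorems.F0P3bPNullGeneration
import HarnessLib

/-!
# FLOOR-0 P3b «ENGINE local packets» — infrastructure III: the null weight spaces `T_w(μ)` of a `(𝔤, K)`-module of
# `U(α, β)` and the IRREDUCIBLE case of the generation lemma (spectrum pinning, `eigenspace(w) = E`, one null weight)

Cell hodgecm-mathlib, FLOOR 0, crux item H413 = stmt-HodgeConjecture-24833; sub-line
`Cruxes/H413/Lines/F0_EngineLocalPackets.lean` (F0P3b-plan, ed. 1 808dda7d).  Helper file (one light definition
`nullWeightSpace` + lemmas), author F0P3-p01 (g2); consumed by the closers of the registered stubs T6a (purity), T6b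
(`dim ≤ 1`), T6c (rigidity).  NO unitarity, NO admissibility, NO classification: only `ad_compat`, irreducibility
(`IsIrreducibleGK`) and `z₀` (★ `F0P3bPPartOperators`, ★ `F0P3bPNullGeneration`).

Content ([BorelWallach2000, II §4.1–4.2]; [Rogawski1990, §15.2]; [VoganZuckerman1984, §5–6]).  `T_w(μ) = {v | pOp μ (x_s) v
= 0 ∀ s, ρz₀ v = w v}` is a null core (`𝔨`-stable: `[ρW, N(x_s)] = N(⁅W, x_s⁆)`, `z₀` central in `𝔨`; `K`-stable: `ad_compat`,
`Ad k z₀ = z₀`).  In an IRREDUCIBLE `(𝔤, K)`-module with a non-zero null core `E` of weight `w` (`μ² = −1`): `gen = ⊤`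
(`gen_eq_top`), every `z₀`-eigenvalue is `w + nμ`, `n ∈ ℕ` (`exists_eq_add_nat_mul_of_eigenspace_ne_bot`, Mathlib
`Module.End.eigenspaces_iSupIndep`), `eigenspace(ρz₀, w) = E` (`eigenspace_eq_of_isNullCore` — so `E` is determined by `w`),
and null vectors occur in the single weight `w` (`nullWeightSpace_eq_bot_of_ne`).

HONEST LABEL: HC_CM is proved only modulo the printed citations until rung 0 closes; this file discharges none of them.
-/

-- Mathlib idiom (as in `GKModules`, `GKCohomology`, the `Upq*` files and the Lines file): commutator bracket on `Module.End`
attribute [local instance 100] LieRing.ofAssociativeRing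

set_option autoImplicit false
set_option linter.dupNamespace false

noncomputable section

namespace Summit.HodgeConjecture.HodgeConjecture.Cruxes.H413.F0P3bPNullIrreducible

open Literature.Algebra.Lie Literature.Algebra.Lie.ChevalleyEilenberg
open Literature.NumberTheory.Automorphic
open Literature.RepresentationTheory.BorelWallach2000
open Literature.RepresentationTheory.KonnoKonno2007 Literature.RepresentationTheory.KonnoKonno2007.RealDualPair
open Literature.RepresentationTheory.KonnoKonno2007.RealDualPair.UForm
open Summit.HodgeConjecture.HodgeConjecture.Cruxes.H413.F0P3bPPartOperators
open Summit.HodgeConjecture.HodgeConjecture.Cruxes.H413.F0P3bPNullGeneration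

variable {α β : Type} [Fintype α] [DecidableEq α] [Fintype β] [DecidableEq β]

/-! ## §4 The null weight spaces `T_w = {v | N(𝔭) v = 0, ρz₀ v = w v}` and the irreducible case -/

section Irreducible

variable {V : Type} [AddCommGroup V] [Module ℂ V]
  (ρK : Representation ℂ (uFormGroup α β).maximalCompact V)
  (ρ𝔤 : (uFormGroup α β).lie →ₗ⁅ℝ⁆ Module.End ℂ V)

/-- **The null weight space `T_w(μ)`**: the `pOp μ`-null vectors (on the frame of `𝔭`) of `z₀`-weight `w`.  For
`μ = δ i`, `w = δ i` it contains every value of a closed `(𝔤, K)`-1-cochain of type `δ` (★ T3j + ★ `mem_upqType_iff`).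
[cite: BorelWallach2000, II §4.2 (3)] -/
def nullWeightSpace (μ w : ℂ) : Submodule ℂ V :=
  (⨅ s : (α × β) × Fin 2, LinearMap.ker (pOp ρ𝔤 μ (upqPBasis s))) ⊓ Module.End.eigenspace (ρ𝔤 (upqZ0 α β)) w

/-- Membership in `T_w(μ)`. [cite: BorelWallach2000, II §4.2 (3)] -/
theorem mem_nullWeightSpace_iff (μ w : ℂ) (v : V) :
    v ∈ nullWeightSpace ρ𝔤 μ w ↔ (∀ s : (α × β) × Fin 2, pOp ρ𝔤 μ (upqPBasis s) v = 0) ∧ ρ𝔤 (upqZ0 α β) v = w • v := by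
  simp only [nullWeightSpace, Submodule.mem_inf, Submodule.mem_iInf, LinearMap.mem_ker, Module.End.mem_eigenspace_iff]

/-- `T_w(μ)` consists of null vectors. [cite: BorelWallach2000, II §4.2 (3)] -/
theorem nullWeightSpace_null (μ w : ℂ) :
    ∀ e ∈ nullWeightSpace ρ𝔤 μ w, ∀ s : (α × β) × Fin 2, pOp ρ𝔤 μ (upqPBasis s) e = 0 :=
  fun e he s => ((mem_nullWeightSpace_iff ρ𝔤 μ w e).1 he).1 s

/-- **`T_w(μ)` is `𝔨`-stable** (`[ρW, N(x_s)] = N(⁅W, x_s⁆)`, `⁅W, x_s⁆ ∈ 𝔭`, and `z₀` is central in `𝔨`).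
[cite: BorelWallach2000, II §4.1] -/
theorem nullWeightSpace_lie_mem (μ w : ℂ) :
    ∀ W ∈ (uFormGroup α β).kInLie, ∀ e ∈ nullWeightSpace ρ𝔤 μ w, ρ𝔤 W e ∈ nullWeightSpace ρ𝔤 μ w := by
  intro W hW e he
  obtain ⟨hnull, hwt⟩ := (mem_nullWeightSpace_iff ρ𝔤 μ w e).1 he
  have hnull' : ∀ X ∈ pPart α β, pOp ρ𝔤 μ X e = 0 := fun X hX => by
    obtain ⟨c, rfl⟩ := exists_sum_upqPBasis_of_mem_pPart X hX
    rw [pOp_sum_smul_apply]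
    exact Finset.sum_eq_zero fun s _ => by rw [hnull s, smul_zero]
  refine (mem_nullWeightSpace_iff ρ𝔤 μ w _).2 ⟨fun s => ?_, ?_⟩
  · have h := lieK_pOp_apply ρ𝔤 μ W hW (upqPBasis s) e
    rw [hnull s, map_zero, hnull' _ (lie_mem_pPart W hW _ (upqPBasis_mem_pPart s)), add_zero] at h
    exact h.symm
  · have e1 := LinearMap.congr_fun (LieHom.map_lie ρ𝔤 (upqZ0 α β) W) e
    rw [lie_upqZ0_eq_zero_of_mem_kInLie W hW, map_zero, LinearMap.zero_apply, Ring.lie_def, LinearMap.sub_apply,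
      Module.End.mul_apply, Module.End.mul_apply] at e1
    rw [← sub_eq_zero, ← map_smul, ← hwt]
    exact e1.symm

/-- **`T_w(μ)` is `K`-stable** (`ad_compat` and `Ad k z₀ = z₀`). [cite: BorelWallach2000, I §5.1 (1); II §4.1] -/
theorem nullWeightSpace_K_mem
    (hV : ∀ (k : (uFormGroup α β).maximalCompact) (X : (uFormGroup α β).lie), ρK k ∘ₗ ρ𝔤 X ∘ₗ ρK k⁻¹ =
      ρ𝔤 ((uFormGroup α β).Ad (Subgroup.inclusion (uFormGroup α β).maximalCompact_le_carrier k) X))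
    (μ w : ℂ) : ∀ (k : (uFormGroup α β).maximalCompact), ∀ e ∈ nullWeightSpace ρ𝔤 μ w, ρK k e ∈ nullWeightSpace ρ𝔤 μ w := by
  intro k e he
  obtain ⟨hnull, hwt⟩ := (mem_nullWeightSpace_iff ρ𝔤 μ w e).1 he
  have hnull' : ∀ X ∈ pPart α β, pOp ρ𝔤 μ X e = 0 := fun X hX => by
    obtain ⟨c, rfl⟩ := exists_sum_upqPBasis_of_mem_pPart X hX
    rw [pOp_sum_smul_apply]
    exact Finset.sum_eq_zero fun s _ => by rw [hnull s, smul_zero]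
  refine (mem_nullWeightSpace_iff ρ𝔤 μ w _).2 ⟨fun s => ?_, ?_⟩
  · have h := K_pOp_apply ρK ρ𝔤 hV μ k
      ((uFormGroup α β).Ad (Subgroup.inclusion (uFormGroup α β).maximalCompact_le_carrier k⁻¹) (upqPBasis s)) e
    rw [hnull' _ (Ad_mem_pPart k⁻¹ _ (upqPBasis_mem_pPart s)), map_zero] at h
    have hAd : (uFormGroup α β).Ad (Subgroup.inclusion (uFormGroup α β).maximalCompact_le_carrier k)
        ((uFormGroup α β).Ad (Subgroup.inclusion (uFormGroup α β).maximalCompact_le_carrier k⁻¹) (upqPBasis s)) =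
        upqPBasis s :=
      (gkPairAction (uFormGroup α β) ρK ρ𝔤 hV).σ_inv_apply k (upqPBasis s)
    rw [hAd] at h
    exact h.symm
  · have h := (gkPairAction (uFormGroup α β) ρK ρ𝔤 hV).compat k (upqZ0 α β) e
    change ρK k (ρ𝔤 (upqZ0 α β) e) = ρ𝔤 ((uFormGroup α β).Ad _ (upqZ0 α β)) (ρK k e) at h
    rw [upq_Ad_upqZ0, hwt, map_smul] at h
    exact h.symm


/-- `T_w(μ)` has `z₀`-weight `w`. [folklore] -/
theorem z0_apply_of_mem_nullWeightSpace (μ w : ℂ) (e : V) (he : e ∈ nullWeightSpace ρ𝔤 μ w) :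
    ρ𝔤 (upqZ0 α β) e = w • e :=
  ((mem_nullWeightSpace_iff ρ𝔤 μ w e).1 he).2

variable {ρK ρ𝔤}

/-- **In an irreducible `(𝔤, K)`-module a non-zero null core generates everything.**
[cite: BorelWallach2000, II §4.1] [cite: KnappVogan1995, §II.4 (after Cor. 2.78)] -/
theorem gen_eq_top (hirr : IsIrreducibleGK ρK ρ𝔤)
    (hV : ∀ (k : (uFormGroup α β).maximalCompact) (X : (uFormGroup α β).lie), ρK k ∘ₗ ρ𝔤 X ∘ₗ ρK k⁻¹ =
      ρ𝔤 ((uFormGroup α β).Ad (Subgroup.inclusion (uFormGroup α β).maximalCompact_le_carrier k) X))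
    {μ : ℂ} {E : Submodule ℂ V} (hEn : ∀ e ∈ E, ∀ s : (α × β) × Fin 2, pOp ρ𝔤 μ (upqPBasis s) e = 0)
    (hEk : ∀ W ∈ (uFormGroup α β).kInLie, ∀ e ∈ E, ρ𝔤 W e ∈ E)
    (hEK : ∀ (k : (uFormGroup α β).maximalCompact), ∀ e ∈ E, ρK k e ∈ E) (hne : E ≠ ⊥) :
    gen ρ𝔤 μ E = ⊤ := by
  rcases hirr.eq_bot_or_eq_top (isGKSubmodule_gen hV hEn hEk hEK) with h | h
  · exact absurd (eq_bot_iff.2 (h ▸ le_gen μ E)) hne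
  · exact h

/-- **The `z₀`-spectrum of an irreducible module with a non-zero null core of weight `w` is `{w + nμ | n ∈ ℕ}`**
(independence of eigenspaces). [cite: BorelWallach2000, II §4.1] -/
theorem exists_eq_add_nat_mul_of_eigenspace_ne_bot (hirr : IsIrreducibleGK ρK ρ𝔤)
    (hV : ∀ (k : (uFormGroup α β).maximalCompact) (X : (uFormGroup α β).lie), ρK k ∘ₗ ρ𝔤 X ∘ₗ ρK k⁻¹ =
      ρ𝔤 ((uFormGroup α β).Ad (Subgroup.inclusion (uFormGroup α β).maximalCompact_le_carrier k) X))
    {μ : ℂ} (hμ : μ * μ = -1) {E : Submodule ℂ V} (hEn : ∀ e ∈ E, ∀ s : (α × β) × Fin 2, pOp ρ𝔤 μ (upqPBasis s) e = 0)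
    (hEk : ∀ W ∈ (uFormGroup α β).kInLie, ∀ e ∈ E, ρ𝔤 W e ∈ E)
    (hEK : ∀ (k : (uFormGroup α β).maximalCompact), ∀ e ∈ E, ρK k e ∈ E) {w : ℂ}
    (hw : ∀ e ∈ E, ρ𝔤 (upqZ0 α β) e = w • e) (hne : E ≠ ⊥) (θ : ℂ)
    (hθ : Module.End.eigenspace (ρ𝔤 (upqZ0 α β)) θ ≠ ⊥) : ∃ n : ℕ, θ = w + n * μ := by
  by_contra hcon
  simp only [not_exists] at hcon
  have h1 : (⊤ : Submodule ℂ V) ≤ ⨆ n : ℕ, Module.End.eigenspace (ρ𝔤 (upqZ0 α β)) (w + n * μ) := by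
    rw [← gen_eq_top hirr hV hEn hEk hEK hne]
    exact gen_le_iSup_eigenspace hμ hw
  have h2 : (⨆ n : ℕ, Module.End.eigenspace (ρ𝔤 (upqZ0 α β)) (w + n * μ)) ≤
      ⨆ (θ' : ℂ) (_ : θ' ≠ θ), Module.End.eigenspace (ρ𝔤 (upqZ0 α β)) θ' :=
    iSup_le fun n => le_iSup₂_of_le (f := fun θ' (_ : θ' ≠ θ) => Module.End.eigenspace (ρ𝔤 (upqZ0 α β)) θ')
      (w + n * μ) (fun h => hcon n h.symm) le_rfl
  have hle : Module.End.eigenspace (ρ𝔤 (upqZ0 α β)) θ ≤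
      ⨆ (θ' : ℂ) (_ : θ' ≠ θ), Module.End.eigenspace (ρ𝔤 (upqZ0 α β)) θ' := le_top.trans (h1.trans h2)
  exact hθ (((Module.End.eigenspaces_iSupIndep (ρ𝔤 (upqZ0 α β))) θ).eq_bot_of_le hle)

/-- **In an irreducible module the weight space of a non-zero null core of weight `w` IS the core**:
`eigenspace(ρz₀, w) = E` (so `E` is determined by `w`, e.g. `E = T_w(μ)` = span of the values of ANY non-zero closed
cochain of the type). [cite: BorelWallach2000, II §4.1] -/
theorem eigenspace_eq_of_isNullCore (hirr : IsIrreducibleGK ρK ρ𝔤)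
    (hV : ∀ (k : (uFormGroup α β).maximalCompact) (X : (uFormGroup α β).lie), ρK k ∘ₗ ρ𝔤 X ∘ₗ ρK k⁻¹ =
      ρ𝔤 ((uFormGroup α β).Ad (Subgroup.inclusion (uFormGroup α β).maximalCompact_le_carrier k) X))
    {μ : ℂ} (hμ : μ * μ = -1) {E : Submodule ℂ V} (hEn : ∀ e ∈ E, ∀ s : (α × β) × Fin 2, pOp ρ𝔤 μ (upqPBasis s) e = 0)
    (hEk : ∀ W ∈ (uFormGroup α β).kInLie, ∀ e ∈ E, ρ𝔤 W e ∈ E)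
    (hEK : ∀ (k : (uFormGroup α β).maximalCompact), ∀ e ∈ E, ρK k e ∈ E) {w : ℂ}
    (hw : ∀ e ∈ E, ρ𝔤 (upqZ0 α β) e = w • e) (hne : E ≠ ⊥) :
    Module.End.eigenspace (ρ𝔤 (upqZ0 α β)) w = E := by
  have hμ0 : μ ≠ 0 := fun h => by rw [h, mul_zero] at hμ; exact one_ne_zero (neg_eq_zero.1 hμ.symm)
  refine le_antisymm (fun v hv => ?_) fun e he => Module.End.mem_eigenspace_iff.2 (hw e he)
  have hvtop : v ∈ gen ρ𝔤 μ E := by rw [gen_eq_top hirr hV hEn hEk hEK hne]; exact Submodule.mem_top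
  rw [gen, iSup_split_single _ 0, Submodule.mem_sup] at hvtop
  obtain ⟨e, he, r, hr, rfl⟩ := hvtop
  rw [grade_zero] at he
  have hr' : r ∈ ⨆ (θ' : ℂ) (_ : θ' ≠ w), Module.End.eigenspace (ρ𝔤 (upqZ0 α β)) θ' := by
    have hsub : (⨆ (n : ℕ) (_ : n ≠ 0), grade ρ𝔤 μ E n) ≤
        ⨆ (θ' : ℂ) (_ : θ' ≠ w), Module.End.eigenspace (ρ𝔤 (upqZ0 α β)) θ' := by
      refine iSup₂_le fun n hn => ?_
      refine le_iSup₂_of_le (f := fun θ' (_ : θ' ≠ w) => Module.End.eigenspace (ρ𝔤 (upqZ0 α β)) θ') (w + n * μ)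
        ?_ (grade_le_eigenspace hμ hw n)
      intro h
      have : (n : ℂ) * μ = 0 := by
        have h' := h
        nth_rw 2 [← add_zero w] at h'
        exact add_left_cancel h'
      rcases mul_eq_zero.1 this with h1 | h1
      · exact hn (by exact_mod_cast h1)
      · exact hμ0 h1
    exact hsub hr
  have hrw : r ∈ Module.End.eigenspace (ρ𝔤 (upqZ0 α β)) w := by
    have := Submodule.sub_mem _ hv (Module.End.mem_eigenspace_iff.2 (hw e he))
    rwa [add_sub_cancel_left] at this
  have hr0 : r = 0 := by
    have h := ((Module.End.eigenspaces_iSupIndep (ρ𝔤 (upqZ0 α β))) w).le_bot (Submodule.mem_inf.2 ⟨hrw, hr'⟩)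
    rwa [Submodule.mem_bot] at h
  rw [hr0, add_zero]
  exact he

/-- **Spectrum pinning by a null weight space**: in an irreducible module with `T_w(μ) ≠ 0` every `z₀`-eigenvalue is
`w + nμ`, `n ∈ ℕ`. [cite: BorelWallach2000, II §4.1] -/
theorem exists_eq_add_nat_mul_of_nullWeightSpace_ne_bot (hirr : IsIrreducibleGK ρK ρ𝔤)
    (hV : ∀ (k : (uFormGroup α β).maximalCompact) (X : (uFormGroup α β).lie), ρK k ∘ₗ ρ𝔤 X ∘ₗ ρK k⁻¹ =
      ρ𝔤 ((uFormGroup α β).Ad (Subgroup.inclusion (uFormGroup α β).maximalCompact_le_carrier k) X))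
    {μ : ℂ} (hμ : μ * μ = -1) {w : ℂ} (hne : nullWeightSpace ρ𝔤 μ w ≠ ⊥) (θ : ℂ)
    (hθ : Module.End.eigenspace (ρ𝔤 (upqZ0 α β)) θ ≠ ⊥) : ∃ n : ℕ, θ = w + n * μ :=
  exists_eq_add_nat_mul_of_eigenspace_ne_bot hirr hV hμ (nullWeightSpace_null ρ𝔤 μ w) (nullWeightSpace_lie_mem ρ𝔤 μ w)
    (nullWeightSpace_K_mem ρK ρ𝔤 hV μ w) (z0_apply_of_mem_nullWeightSpace ρ𝔤 μ w) hne θ hθ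

/-- **In an irreducible module with `T_w(μ) ≠ 0`, `eigenspace(ρz₀, w) = T_w(μ)`**: every vector of weight `w` is
null. [cite: BorelWallach2000, II §4.1] -/
theorem eigenspace_eq_nullWeightSpace (hirr : IsIrreducibleGK ρK ρ𝔤)
    (hV : ∀ (k : (uFormGroup α β).maximalCompact) (X : (uFormGroup α β).lie), ρK k ∘ₗ ρ𝔤 X ∘ₗ ρK k⁻¹ =
      ρ𝔤 ((uFormGroup α β).Ad (Subgroup.inclusion (uFormGroup α β).maximalCompact_le_carrier k) X))
    {μ : ℂ} (hμ : μ * μ = -1) {w : ℂ} (hne : nullWeightSpace ρ𝔤 μ w ≠ ⊥) :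
    Module.End.eigenspace (ρ𝔤 (upqZ0 α β)) w = nullWeightSpace ρ𝔤 μ w :=
  eigenspace_eq_of_isNullCore hirr hV hμ (nullWeightSpace_null ρ𝔤 μ w) (nullWeightSpace_lie_mem ρ𝔤 μ w)
    (nullWeightSpace_K_mem ρK ρ𝔤 hV μ w) (z0_apply_of_mem_nullWeightSpace ρ𝔤 μ w) hne

/-- **Null vectors of an irreducible module live in ONE weight**: if `T_w(μ) ≠ 0` then `T_θ(μ) = 0` for `θ ≠ w`
(apply the spectrum pinning to both). [cite: BorelWallach2000, II §4.1] -/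
theorem nullWeightSpace_eq_bot_of_ne (hirr : IsIrreducibleGK ρK ρ𝔤)
    (hV : ∀ (k : (uFormGroup α β).maximalCompact) (X : (uFormGroup α β).lie), ρK k ∘ₗ ρ𝔤 X ∘ₗ ρK k⁻¹ =
      ρ𝔤 ((uFormGroup α β).Ad (Subgroup.inclusion (uFormGroup α β).maximalCompact_le_carrier k) X))
    {μ : ℂ} (hμ : μ * μ = -1) {w : ℂ} (hne : nullWeightSpace ρ𝔤 μ w ≠ ⊥) {θ : ℂ} (hθ : θ ≠ w) :
    nullWeightSpace ρ𝔤 μ θ = ⊥ := by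
  have hμ0 : μ ≠ 0 := fun h => by rw [h, mul_zero] at hμ; exact one_ne_zero (neg_eq_zero.1 hμ.symm)
  by_contra hθne
  have hEθ : Module.End.eigenspace (ρ𝔤 (upqZ0 α β)) θ ≠ ⊥ := fun h =>
    hθne (eq_bot_iff.2 (h ▸ (inf_le_right : nullWeightSpace ρ𝔤 μ θ ≤ _)))
  have hEw : Module.End.eigenspace (ρ𝔤 (upqZ0 α β)) w ≠ ⊥ := fun h =>
    hne (eq_bot_iff.2 (h ▸ (inf_le_right : nullWeightSpace ρ𝔤 μ w ≤ _)))
  obtain ⟨n, hn⟩ := exists_eq_add_nat_mul_of_nullWeightSpace_ne_bot hirr hV hμ hne θ hEθ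
  obtain ⟨n', hn'⟩ := exists_eq_add_nat_mul_of_nullWeightSpace_ne_bot hirr hV hμ hθne w hEw
  have h0 : ((n + n' : ℕ) : ℂ) * μ = 0 := by
    have e : w = w + ((n : ℂ) * μ + (n' : ℂ) * μ) := by
      conv_lhs => rw [hn', hn]
      ring
    nth_rw 1 [← add_zero w] at e
    have e' := add_left_cancel e
    push_cast
    rw [add_mul, ← e']
  rcases mul_eq_zero.1 h0 with h1 | h1
  · have hnn : n + n' = 0 := by exact_mod_cast h1
    have hn0 : n = 0 := by omega
    rw [hn0, Nat.cast_zero, zero_mul, add_zero] at hn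
    exact hθ hn
  · exact hμ0 h1

end Irreducible




end Summit.HodgeConjecture.HodgeConjecture.Cruxes.H413.F0P3bPNullIrreducible

end
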